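import Summits.ResolutionOfSingularities.ResolutionOfSingularities.Theorems.EquisingularLiftEquisingularLiftNatF102TwoSections
import Summits.ResolutionOfSingularities.ResolutionOfSingularities.Theorems.EquisingularLiftEquisingularLiftNatF102Integral
import Summits.ResolutionOfSingularities.ResolutionOfSingularities.Theorems.EquisingularLiftEquisingularLiftNatF102Dominant
import Summits.ResolutionOfSingularities.ResolutionOfSingularities.Theorems.EquisingularLiftEquisingularLiftNatF102QuasiFinite
import Summits.ResolutionOfSingularities.ResolutionOfSingularities.Theorems.EquisingularLiftEquisingularLiftNatF102IsoOfCharts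
import Summits.ResolutionOfSingularities.ResolutionOfSingularities.Theorems.EquisingularLiftEquisingularLiftNatF102PullbackSheafHomTrivial
import Summits.ResolutionOfSingularities.ResolutionOfSingularities.Theorems.EquisingularLiftEquisingularLiftNatF102CoordinateFunctionsOfTrivialPullback
import Summits.ResolutionOfSingularities.ResolutionOfSingularities.Theorems.EquisingularLiftEquisingularLiftNatF102MorphismPPAssembly
import Literature.AlgebraicGeometry.Resolution.GenusZeroOverCompleteDVR
import HarnessLib

/-!
# [OURS · L1 W4.5(b) · LINE (T-j)-PROOF — ASSEMBLY] F-102 `GenusZeroOverCompleteDVR` is a THEOREM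

Cell res-hironaka, LADDER-RESOLUTION rung L, slot W4.5(b), crux chain w45b: EL♮(3) = stmt-ResolutionOfSingularities-20148
(`Theses.EquisingularLift.EquisingularLiftNatThree`), residue (T-j) = fact F-102
`Literature.AlgebraicGeometry.Resolution.GenusZeroOverCompleteDVR` (typed by res-L1-type-o6, p571563; FACT CLAIM res-L1-w45b-lead-2):
«a proper flat regular curve over a complete DVR `O` with algebraically closed residue field whose closed fibre is `ℙ¹` is `ℙ¹_O`».
LINE (T-j)-PROOF (res-L1-w45b-lead-2 g3, skeleton v3 1683bb741349c142), assembled here from the landed bricks of the crux chain: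

* B12 `exists_two_disjoint_sections_through` (lead-2, p575734): Hensel sections `s₀ ∋ i(e⁻¹(1:0))`, `s₁ ∋ i(e⁻¹(0:1))`, disjoint;
* G1 `isIntegral_of_isRegular` (lead-2, p575507);
* (γ*) `nonempty_pullback_sheafHom_idealModule_iso_unit` (lead-2 …NatF102PullbackSheafHomTrivial over (α) lead-2 p582776, (β) res-D-pv-036
  p581953, (γ) res-rescue-typ-5 p581858, PointIdeal res-L1-type-o6, ring core res-D-pv-036): `i^*𝓗om(𝓘_{D₀}, 𝓘_{D₁}) ≅ 𝒪_{C_k}`;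
* B4 `exists_coordinate_functions_of_trivial_pullback` (res-L1-type-o6 p581462 over (a1)(a2)(a3)(d)(d′)(e)(f); brick E lead-2 p574087;
  (G2) res-D-pv-036; (G3) res-D-pv-036): the coordinate pair `t₀ ∈ Γ(C ∖ D₀)`, `t₁ ∈ Γ(C ∖ D₁)`, `t₀ t₁ = 1`, generating `𝓘_{D₁}`, `𝓘_{D₀}`;
* S5 `exists_morphism_PP_of_coordinates` (res-L1-w45b-stub-3 p581449 over S5a p575419, p576855, p578600, p579217, p579610, p580175;
  res-D-pv-035 p578000; res-L1-w45b-stub-4 (K) p580844): the morphism `φ : C → ℙ¹_O` over `O`, injective with full image on the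
  closed fibre, chart sections onto modulo `ϖ`;
* S6 `isFinite_of_subsingleton_closedFibre` (res-D-pv-035/036, …NatF102QuasiFinite); G4 `genericPoints_subset_range` (lead-2, p576498);
  S7 `isIso_of_isFinite_of_charts` (res-D-pv-036, p575460): `φ` is an isomorphism.

`--supports stmt-ResolutionOfSingularities-20148 --as helper` (the fact discharges `hF102`/`hTj` of the n = 3 rung closers via res-L1-type-o6's
`rationalCarrierLift_of_genusZeroOverCompleteDVR`, p572358). NOT a statement of any manuscript beyond the classical fact it proves
(Lønsted–Kleiman 1979 §3; Liu 2002 Ch. 8–9, genus-0 case); OURS; AI-written, weaker than expert review. No `sorry`; standard axioms; DEF-FREE.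
-/

noncomputable section

open CategoryTheory AlgebraicGeometry TopologicalSpace Opposite IsLocalRing
open Literature.AlgebraicGeometry Literature.AlgebraicGeometry.Morphisms Literature.AlgebraicGeometry.Motives
open Literature.AlgebraicGeometry.Modules Literature.AlgebraicGeometry.Deformation

set_option linter.dupNamespace false -- mandated namespace `Summit.<Summit>.<Problem>` of this single-conjunct summit

namespace Summit.ResolutionOfSingularities.ResolutionOfSingularities.Cruxes.EquisingularLiftNat.F102

/-- **F-102 `GenusZeroOverCompleteDVR` holds.** A proper flat regular `O`-curve (`O` a complete DVR with algebraically closed residue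
field `k`) whose closed fibre is isomorphic to `ℙ¹_{k'}` is `O`-isomorphic to `ℙ¹_O`. Assembly of LINE (T-j)-PROOF:
two disjoint Hensel sections; the special-fibre triviality of `𝓗om(𝓘_{D₀}, 𝓘_{D₁})`; lifting to an isomorphism `𝓘_{D₀} ≅ 𝓘_{D₁}`
and its coordinate pair; the morphism `φ : C → ℙ¹_O`; `φ` finite (injective on the closed fibre), dominant, an iso on charts modulo
`ϖ`, hence an isomorphism. [cite: LonstedKleiman1979, §3 (relative curves of genus 0)] [cite: Liu2002, Ch. 8] [OURS · proof] -/
theorem genusZeroOverCompleteDVR_holds : Literature.AlgebraicGeometry.Resolution.GenusZeroOverCompleteDVR.{0} := by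
  intro O _ _ _ _ k _ _ θ hθ C f _ _ hreg Ck i t hsq hP1
  haveI : IsIntegral C := isIntegral_of_isRegular O k θ C f Ck i t hθ hreg hsq hP1
  -- B12: two disjoint sections through `e⁻¹(1:0)`, `e⁻¹(0:1)`
  obtain ⟨k', _, e, s₀, s₁, hs₀, hs₁, hz₀, hz₁, hdisj⟩ :=
    exists_two_disjoint_sections_through O k θ C f Ck i t hθ hreg hsq hP1
  have hP1' : ∃ (k' : Type) (_ : Field k'), Nonempty (Ck ≅ ProjCech.PP k' 1) := ⟨k', inferInstance, ⟨e⟩⟩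
  haveI : IsClosedImmersion s₀ := (isRegularImmersionOfCodim_one_of_section O k θ C f Ck i t hθ hreg hsq hP1' s₀ hs₀).1
  haveI : IsClosedImmersion s₁ := (isRegularImmersionOfCodim_one_of_section O k θ C f Ck i t hθ hreg hsq hP1' s₁ hs₁).1
  -- the opens `W_j = C ∖ D_j`
  let W₀ : C.Opens := ⟨(Set.range s₀.base)ᶜ, s₀.isClosedEmbedding.isClosed_range.isOpen_compl⟩
  let W₁ : C.Opens := ⟨(Set.range s₁.base)ᶜ, s₁.isClosedEmbedding.isClosed_range.isOpen_compl⟩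
  have hW₀ : s₀ ⁻¹ᵁ W₀ = ⊥ := by
    ext x
    simp only [Opens.map_coe, Set.mem_preimage, Opens.coe_bot, Set.mem_empty_iff_false, iff_false]
    exact fun h => h ⟨x, rfl⟩
  have hW₁ : s₁ ⁻¹ᵁ W₁ = ⊥ := by
    ext x
    simp only [Opens.map_coe, Set.mem_preimage, Opens.coe_bot, Set.mem_empty_iff_false, iff_false]
    exact fun h => h ⟨x, rfl⟩
  -- (γ*) and B4: the coordinate pair
  have hN := nonempty_pullback_sheafHom_idealModule_iso_unit O k θ C f Ck i t hθ hreg hsq k' e s₀ s₁ hs₀ hs₁ hz₀ hz₁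
  obtain ⟨t₀, t₁, hmul, hgen₀, hgen₁⟩ :=
    exists_coordinate_functions_of_trivial_pullback O k θ C f Ck i t hθ hreg hsq k' e s₀ s₁ hs₀ hs₁ hN W₀ W₁ hW₀ hW₁
  -- S5: the morphism to `ℙ¹_O`
  obtain ⟨φ, hφ, hinj, hsurj, hmod⟩ :=
    exists_morphism_PP_of_coordinates O k θ C f Ck i t hθ hsq k' e s₀ s₁ hs₀ hs₁ hz₀ hz₁ hdisj W₀ W₁ rfl rfl t₀ t₁
      hmul hgen₀ hgen₁
  -- S6, G4, S7
  haveI : IsFinite φ := isFinite_of_subsingleton_closedFibre O k θ C f Ck i t hθ hreg hsq hP1 φ hφ hinj hsurj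
  have hdom := genericPoints_subset_range O k θ C f Ck i t hθ hsq hP1 φ hφ hinj hsurj
  haveI : IsIso φ := isIso_of_isFinite_of_charts O C f φ hφ hdom hmod
  exact ⟨asIso φ, hφ⟩

/-- `X_holds`-named alias of `genusZeroOverCompleteDVR_holds` (fact-claim discharge convention). [OURS · proof] -/
theorem GenusZeroOverCompleteDVR_holds : Literature.AlgebraicGeometry.Resolution.GenusZeroOverCompleteDVR.{0} :=
  genusZeroOverCompleteDVR_holds

end Summit.ResolutionOfSingularities.ResolutionOfSingularities.Cruxes.EquisingularLiftNat.F102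

end
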